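import Literature.NumberTheory.CubicFields.BinaryCubicForms
import Mathlib.RingTheory.Discriminant
import Mathlib.LinearAlgebra.Matrix.Determinant.Basic
import HarnessLib

/-!
# The cubic ring of a binary cubic form (Levi–Delone–Faddeev, the construction): multiplication table, rank `3`, `Disc R(f) = Disc f`

Topic `Literature/NumberTheory/CubicFields`, continuing `BinaryCubicForms.lean` (the lattice
`V(ℤ)` of integral binary cubic forms `f = a u³ + b u²v + c uv² + d v³`, `Disc`, the twisted
`GL₂(ℤ)`-action; Bhargava–Taniguchi–Thorne 2023, §2.2).

BTT §2.1–2.2: "A cubic ring (over `ℤ`) is a commutative ring that is free of rank 3 as a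
`ℤ`-module. Its discriminant is the determinant of the trace form `⟨x, y⟩ = Tr(xy)`." …
"Theorem 2.1 ([Levi, Delone–Faddeev, Gan–Gross–Savin]). There is a canonical,
discriminant-preserving bijection between the set of `GL₂(ℤ)`-orbits on `V(ℤ)` and the set of
isomorphism classes of cubic rings." This file formalizes the CONSTRUCTION half of that
correspondence — the cubic ring `R(f)` attached to a form — in the explicit normal form of
Bhargava–Shankar–Tsimerman, §2 (after Delone–Faddeev and Gan–Gross–Savin §4): `R(f)` has a
`ℤ`-basis `1, ω, θ` with
`ω θ = −ad`, `ω² = −ac + bω − aθ`, `θ² = −bd + dω − cθ`,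
and proves what BTT's definition of "cubic ring" and "discriminant-preserving" ask of it:

* `RingOfForm f` — the type `ℤ³` (coordinates on `1, ω, θ`) with this multiplication, a
  `CommRing` (all axioms are polynomial identities in the coordinates, closed by `ring`);
* `RingOfForm.omega_mul_theta`, `omega_sq`, `theta_sq` — the printed multiplication table;
* `RingOfForm.basis` — the `ℤ`-basis `(1, ω, θ)` (`basis_zero/one/two`), so `R(f)` is free of
  rank `3` (`finrank_eq_three`): a cubic ring in the sense of BTT §2.1;
* `RingOfForm.discr_basis_eq_disc` — **`Disc R(f) = Disc f`**: the discriminant of the trace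
  form on the basis `(1, ω, θ)` (Mathlib's `Algebra.discr ℤ`) is
  `b²c² − 4ac³ − 4b³d − 27a²d² + 18abcd` (the trace matrix is
  `[[3, b, −c], [b, b² − 2ac, −3ad], [−c, −3ad, c² − 2bd]]`, `traceMatrix_eq`).

NOT here: the other half of Thm 2.1 (every cubic ring arises, from a unique `GL₂(ℤ)`-orbit:
`R(γ·f) ≅ R(f)` and the converse), irreducible forms ↔ orders in cubic fields, `Aut(R) ≅ Stab(f)`,
and the Davenport–Heilbronn maximality conditions (BTT Prop. 2.2).

## References

* M. Bhargava, T. Taniguchi, F. Thorne, *Improved error estimates for the Davenport–Heilbronn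
  theorems*, Math. Ann. 389 (2024) = arXiv:2107.12819, §2.1 and Thm 2.1 [BhargavaTaniguchiThorne2023].
* M. Bhargava, A. Shankar, J. Tsimerman, *On the Davenport–Heilbronn theorems and second order
  terms*, Invent. Math. 193 (2013), §2 (the multiplication table of `R(f)`) [BhargavaShankarTsimerman2012].
* W. T. Gan, B. Gross, G. Savin, *Fourier coefficients of modular forms on `G₂`*, Duke Math. J. 115
  (2002), §4 [GanGrossSavin2002].
* H. Davenport, H. Heilbronn, *On the density of discriminants of cubic fields. II*, Proc. Roy.
  Soc. London A 322 (1971) [DavenportHeilbronn1971].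

## Design

`RingOfForm f` is a three-field structure indexed by the form `f` (a phantom parameter, so that
each form has its own ring), with the operations registered as instances and coordinate `simp`
lemmas, then `CommRing` assembled as for Mathlib's `Zsqrtd`. The basis is `Module.Basis.ofEquivFun` of the
coordinate isomorphism with `Fin 3 → ℤ`; the discriminant is Mathlib's `Algebra.discr ℤ` of that
basis, unfolded through `Algebra.traceMatrix`, `Algebra.trace_eq_matrix_trace` and
`Algebra.leftMulMatrix_eq_repr_mul`.
-/

namespace Literature.NumberTheory.CubicFields

open BinaryCubic

/-- The cubic ring `R(f)` of an integral binary cubic form `f = (a, b, c, d)`: as a `ℤ`-module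
`ℤ·1 ⊕ ℤ·ω ⊕ ℤ·θ` (an element is stored as its coordinates `(x, y, z) ↦ x + yω + zθ`), with the
multiplication determined by `ωθ = −ad`, `ω² = −ac + bω − aθ`, `θ² = −bd + dω − cθ`
(Bhargava–Shankar–Tsimerman 2013, §2; Levi, Delone–Faddeev, Gan–Gross–Savin §4; the ring of
BTT 2023, Thm 2.1). [cite: BhargavaShankarTsimerman2012, §2 (the cubic ring R(f))] -/
@[ext]
structure RingOfForm (f : BinaryCubic ℤ) where
  /-- coordinate on `1` [folklore] -/
  x : ℤ
  /-- coordinate on `ω` [folklore] -/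
  y : ℤ
  /-- coordinate on `θ` [folklore] -/
  z : ℤ

namespace RingOfForm

variable {f : BinaryCubic ℤ}

/-! ### The ring structure -/

/-- Zero of `R(f)`. [folklore] -/
instance : Zero (RingOfForm f) := ⟨⟨0, 0, 0⟩⟩
/-- One of `R(f)` (the basis vector `1`). [folklore] -/
instance : One (RingOfForm f) := ⟨⟨1, 0, 0⟩⟩
/-- Coordinatewise addition. [folklore] -/
instance : Add (RingOfForm f) := ⟨fun p q => ⟨p.x + q.x, p.y + q.y, p.z + q.z⟩⟩
/-- Coordinatewise negation. [folklore] -/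
instance : Neg (RingOfForm f) := ⟨fun p => ⟨-p.x, -p.y, -p.z⟩⟩

/-- The multiplication of `R(f)`: expand `(x₁ + y₁ω + z₁θ)(x₂ + y₂ω + z₂θ)` with
`ωθ = −ad`, `ω² = −ac + bω − aθ`, `θ² = −bd + dω − cθ`. [cite: BhargavaShankarTsimerman2012, §2 (multiplication table of R(f))] -/
instance : Mul (RingOfForm f) :=
  ⟨fun p q => ⟨p.x * q.x - f.a * f.c * (p.y * q.y) - f.a * f.d * (p.y * q.z + p.z * q.y)
        - f.b * f.d * (p.z * q.z),
      p.x * q.y + p.y * q.x + f.b * (p.y * q.y) + f.d * (p.z * q.z),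
      p.x * q.z + p.z * q.x - f.a * (p.y * q.y) - f.c * (p.z * q.z)⟩⟩

/-- coordinates of `0` [folklore] -/ @[simp] theorem zero_x : (0 : RingOfForm f).x = 0 := rfl
/-- coordinates of `0` [folklore] -/ @[simp] theorem zero_y : (0 : RingOfForm f).y = 0 := rfl
/-- coordinates of `0` [folklore] -/ @[simp] theorem zero_z : (0 : RingOfForm f).z = 0 := rfl
/-- coordinates of `1` [folklore] -/ @[simp] theorem one_x : (1 : RingOfForm f).x = 1 := rfl
/-- coordinates of `1` [folklore] -/ @[simp] theorem one_y : (1 : RingOfForm f).y = 0 := rfl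
/-- coordinates of `1` [folklore] -/ @[simp] theorem one_z : (1 : RingOfForm f).z = 0 := rfl
/-- coordinates of a sum [folklore] -/ @[simp] theorem add_x (p q : RingOfForm f) : (p + q).x = p.x + q.x := rfl
/-- coordinates of a sum [folklore] -/ @[simp] theorem add_y (p q : RingOfForm f) : (p + q).y = p.y + q.y := rfl
/-- coordinates of a sum [folklore] -/ @[simp] theorem add_z (p q : RingOfForm f) : (p + q).z = p.z + q.z := rfl
/-- coordinates of a negative [folklore] -/ @[simp] theorem neg_x (p : RingOfForm f) : (-p).x = -p.x := rfl
/-- coordinates of a negative [folklore] -/ @[simp] theorem neg_y (p : RingOfForm f) : (-p).y = -p.y := rfl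
/-- coordinates of a negative [folklore] -/ @[simp] theorem neg_z (p : RingOfForm f) : (-p).z = -p.z := rfl
/-- coordinates of a product [folklore] -/
@[simp] theorem mul_x (p q : RingOfForm f) : (p * q).x =
    p.x * q.x - f.a * f.c * (p.y * q.y) - f.a * f.d * (p.y * q.z + p.z * q.y) - f.b * f.d * (p.z * q.z) := rfl
/-- coordinates of a product [folklore] -/
@[simp] theorem mul_y (p q : RingOfForm f) : (p * q).y =
    p.x * q.y + p.y * q.x + f.b * (p.y * q.y) + f.d * (p.z * q.z) := rfl
/-- coordinates of a product [folklore] -/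
@[simp] theorem mul_z (p q : RingOfForm f) : (p * q).z =
    p.x * q.z + p.z * q.x - f.a * (p.y * q.y) - f.c * (p.z * q.z) := rfl

/-- `R(f)` is an additive commutative group (coordinatewise). [folklore] -/
instance addCommGroup : AddCommGroup (RingOfForm f) := by
  refine
  { sub := fun p q => p + -q
    nsmul := @nsmulRec (RingOfForm f) ⟨0⟩ ⟨(· + ·)⟩
    zsmul := @zsmulRec (RingOfForm f) ⟨0⟩ ⟨(· + ·)⟩ ⟨Neg.neg⟩ (@nsmulRec (RingOfForm f) ⟨0⟩ ⟨(· + ·)⟩)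
    add_assoc := ?_
    zero_add := ?_
    add_zero := ?_
    neg_add_cancel := ?_
    add_comm := ?_ } <;>
  intros <;> ext <;> simp [add_comm, add_left_comm]

/-- coordinates of a difference [folklore] -/
@[simp] theorem sub_x (p q : RingOfForm f) : (p - q).x = p.x - q.x := by
  change (p + -q).x = _; simp [sub_eq_add_neg]
/-- coordinates of a difference [folklore] -/
@[simp] theorem sub_y (p q : RingOfForm f) : (p - q).y = p.y - q.y := by
  change (p + -q).y = _; simp [sub_eq_add_neg]
/-- coordinates of a difference [folklore] -/
@[simp] theorem sub_z (p q : RingOfForm f) : (p - q).z = p.z - q.z := by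
  change (p + -q).z = _; simp [sub_eq_add_neg]

/-- The structure map `ℤ → R(f)`, `n ↦ n·1`. [folklore] -/
def ofInt (n : ℤ) : RingOfForm f := ⟨n, 0, 0⟩

/-- coordinates of `ofInt` [folklore] -/ @[simp] theorem ofInt_x (n : ℤ) : (ofInt n : RingOfForm f).x = n := rfl
/-- coordinates of `ofInt` [folklore] -/ @[simp] theorem ofInt_y (n : ℤ) : (ofInt n : RingOfForm f).y = 0 := rfl
/-- coordinates of `ofInt` [folklore] -/ @[simp] theorem ofInt_z (n : ℤ) : (ofInt n : RingOfForm f).z = 0 := rfl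

/-- `R(f)` with its integer casts. [folklore] -/
instance addGroupWithOne : AddGroupWithOne (RingOfForm f) :=
  { RingOfForm.addCommGroup with
    natCast := fun n => ofInt n
    intCast := ofInt
    one := 1 }

/-- coordinates of a natural-number cast [folklore] -/
@[simp] theorem natCast_x (n : ℕ) : (n : RingOfForm f).x = n := rfl
/-- coordinates of a natural-number cast [folklore] -/
@[simp] theorem natCast_y (n : ℕ) : (n : RingOfForm f).y = 0 := rfl
/-- coordinates of a natural-number cast [folklore] -/
@[simp] theorem natCast_z (n : ℕ) : (n : RingOfForm f).z = 0 := rfl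
/-- coordinates of an integer cast [folklore] -/
@[simp] theorem intCast_x (n : ℤ) : (n : RingOfForm f).x = n := rfl
/-- coordinates of an integer cast [folklore] -/
@[simp] theorem intCast_y (n : ℤ) : (n : RingOfForm f).y = 0 := rfl
/-- coordinates of an integer cast [folklore] -/
@[simp] theorem intCast_z (n : ℤ) : (n : RingOfForm f).z = 0 := rfl

/-- **`R(f)` is a commutative ring**: associativity, commutativity and distributivity of the
Delone–Faddeev multiplication are polynomial identities in the coordinates (the content of the
statement that the printed table defines a ring; BST §2). [cite: BhargavaShankarTsimerman2012, §2 (R(f) is a cubic ring)] -/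
instance commRing : CommRing (RingOfForm f) := by
  refine
  { RingOfForm.addGroupWithOne with
    npow := @npowRec (RingOfForm f) ⟨1⟩ ⟨(· * ·)⟩,
    add_comm := ?_
    left_distrib := ?_
    right_distrib := ?_
    zero_mul := ?_
    mul_zero := ?_
    mul_assoc := ?_
    one_mul := ?_
    mul_one := ?_
    mul_comm := ?_ } <;>
  intros <;> ext <;> simp <;> ring

/-! ### The basis `1, ω, θ` and the multiplication table -/

/-- The basis element `ω` of `R(f)`. [cite: BhargavaShankarTsimerman2012, §2 (basis 1, ω, θ)] -/
def omega (f : BinaryCubic ℤ) : RingOfForm f := ⟨0, 1, 0⟩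

/-- The basis element `θ` of `R(f)`. [cite: BhargavaShankarTsimerman2012, §2 (basis 1, ω, θ)] -/
def theta (f : BinaryCubic ℤ) : RingOfForm f := ⟨0, 0, 1⟩

/-- coordinates of `ω` [folklore] -/ @[simp] theorem omega_x : (omega f).x = 0 := rfl
/-- coordinates of `ω` [folklore] -/ @[simp] theorem omega_y : (omega f).y = 1 := rfl
/-- coordinates of `ω` [folklore] -/ @[simp] theorem omega_z : (omega f).z = 0 := rfl
/-- coordinates of `θ` [folklore] -/ @[simp] theorem theta_x : (theta f).x = 0 := rfl
/-- coordinates of `θ` [folklore] -/ @[simp] theorem theta_y : (theta f).y = 0 := rfl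
/-- coordinates of `θ` [folklore] -/ @[simp] theorem theta_z : (theta f).z = 1 := rfl

/-- Every element is `x·1 + y·ω + z·θ`. [folklore] -/
theorem eq_coord_combination (p : RingOfForm f) :
    p = (p.x : RingOfForm f) + (p.y : RingOfForm f) * omega f + (p.z : RingOfForm f) * theta f := by
  ext <;> simp

/-- **`ωθ = −ad`** (BST §2). [cite: BhargavaShankarTsimerman2012, §2 (ωθ = −ad)] -/
theorem omega_mul_theta : omega f * theta f = ((-(f.a * f.d) : ℤ) : RingOfForm f) := by
  ext <;> simp

/-- **`ω² = −ac + bω − aθ`** (BST §2). [cite: BhargavaShankarTsimerman2012, §2 (ω² = −ac + bω − aθ)] -/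
theorem omega_sq : omega f * omega f =
    ((-(f.a * f.c) : ℤ) : RingOfForm f) + (f.b : RingOfForm f) * omega f - (f.a : RingOfForm f) * theta f := by
  ext <;> simp

/-- **`θ² = −bd + dω − cθ`** (BST §2). [cite: BhargavaShankarTsimerman2012, §2 (θ² = −bd + dω − cθ)] -/
theorem theta_sq : theta f * theta f =
    ((-(f.b * f.d) : ℤ) : RingOfForm f) + (f.d : RingOfForm f) * omega f - (f.c : RingOfForm f) * theta f := by
  ext <;> simp

/-- The coordinate isomorphism `R(f) ≃ₗ[ℤ] ℤ³`. [folklore] -/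
def coordEquiv (f : BinaryCubic ℤ) : RingOfForm f ≃ₗ[ℤ] (Fin 3 → ℤ) where
  toFun p := ![p.x, p.y, p.z]
  invFun v := ⟨v 0, v 1, v 2⟩
  map_add' p q := by ext i; fin_cases i <;> simp
  map_smul' n p := by
    ext i
    fin_cases i <;> simp [zsmul_eq_mul]
  left_inv p := by ext <;> simp
  right_inv v := by ext i; fin_cases i <;> simp

/-- **`R(f)` is free of rank `3`**: the `ℤ`-basis `(1, ω, θ)` (BTT 2023, §2.1: "a cubic ring is a
commutative ring that is free of rank 3 as a `ℤ`-module"). [cite: BhargavaTaniguchiThorne2023, §2.1 (cubic ring)] -/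
noncomputable def basis (f : BinaryCubic ℤ) : Module.Basis (Fin 3) ℤ (RingOfForm f) :=
  Module.Basis.ofEquivFun (coordEquiv f)

/-- `basis 0 = 1`. [folklore] -/
@[simp] theorem basis_zero : basis f 0 = 1 := by
  ext <;> simp [basis, coordEquiv]

/-- `basis 1 = ω`. [folklore] -/
@[simp] theorem basis_one : basis f 1 = omega f := by
  ext <;> simp [basis, coordEquiv, omega]

/-- `basis 2 = θ`. [folklore] -/
@[simp] theorem basis_two : basis f 2 = theta f := by
  ext <;> simp [basis, coordEquiv, theta]

/-- Coordinates in the basis `(1, ω, θ)` are the stored coordinates. [folklore] -/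
@[simp] theorem basis_repr_apply (p : RingOfForm f) (i : Fin 3) :
    (basis f).repr p i = ![p.x, p.y, p.z] i := by
  simp [basis, coordEquiv]

/-- `R(f)` has rank `3` over `ℤ`. [cite: BhargavaTaniguchiThorne2023, §2.1 (cubic ring = free of rank 3)] -/
theorem finrank_eq_three : Module.finrank ℤ (RingOfForm f) = 3 := by
  rw [Module.finrank_eq_card_basis (basis f), Fintype.card_fin]

/-- `R(f)` is a free `ℤ`-module. [folklore] -/
instance : Module.Free ℤ (RingOfForm f) := Module.Free.of_basis (basis f)

/-- `R(f)` is a finite `ℤ`-module. [folklore] -/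
instance : Module.Finite ℤ (RingOfForm f) := Module.Finite.of_basis (basis f)

/-! ### The trace form and `Disc R(f) = Disc f` -/

/-- The matrix of multiplication by `p` in the basis `(1, ω, θ)` (Mathlib's `leftMulMatrix`).
[folklore] -/
theorem leftMulMatrix_eq (p : RingOfForm f) :
    Algebra.leftMulMatrix (basis f) p =
      !![p.x, -f.a * f.c * p.y - f.a * f.d * p.z, -f.a * f.d * p.y - f.b * f.d * p.z;
         p.y, p.x + f.b * p.y, f.d * p.z;
         p.z, -f.a * p.y, p.x - f.c * p.z] := by
  ext i j
  rw [Algebra.leftMulMatrix_eq_repr_mul, basis_repr_apply]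
  fin_cases i <;> fin_cases j <;> simp

/-- The trace of multiplication by `p = x + yω + zθ` is `3x + by − cz`. [folklore] -/
theorem trace_eq (p : RingOfForm f) :
    Algebra.trace ℤ (RingOfForm f) p = 3 * p.x + f.b * p.y - f.c * p.z := by
  rw [Algebra.trace_eq_matrix_trace (basis f), leftMulMatrix_eq, Matrix.trace_fin_three]
  simp
  ring

/-- **The trace form of `R(f)` on `(1, ω, θ)`** is
`[[3, b, −c], [b, b² − 2ac, −3ad], [−c, −3ad, c² − 2bd]]`. [folklore] -/
theorem traceMatrix_eq (f : BinaryCubic ℤ) :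
    Algebra.traceMatrix ℤ (basis f) =
      !![3, f.b, -f.c;
         f.b, f.b ^ 2 - 2 * f.a * f.c, -3 * f.a * f.d;
         -f.c, -3 * f.a * f.d, f.c ^ 2 - 2 * f.b * f.d] := by
  ext i j
  rw [Algebra.traceMatrix_apply, Algebra.traceForm_apply, trace_eq]
  fin_cases i <;> fin_cases j <;> simp <;> ring

/-- **`Disc R(f) = Disc f`**: the discriminant of the cubic ring of `f` — the determinant of its
trace form `⟨x, y⟩ = Tr(xy)` (BTT 2023, §2.1), here Mathlib's `Algebra.discr ℤ` on the basis
`(1, ω, θ)` — equals `Disc(f) = b²c² − 4ac³ − 4b³d − 27a²d² + 18abcd`: the Levi–Delone–Faddeev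
map `f ↦ R(f)` is "discriminant-preserving" (BTT Thm 2.1). [cite: BhargavaTaniguchiThorne2023, Theorem 2.1 (discriminant-preserving)] -/
theorem discr_basis_eq_disc (f : BinaryCubic ℤ) : Algebra.discr ℤ (basis f) = f.disc := by
  rw [Algebra.discr_def, traceMatrix_eq, Matrix.det_fin_three, disc_eq]
  simp
  ring

end RingOfForm

end Literature.NumberTheory.CubicFields
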